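import Summits.CriticalPhenomena.CardyFormulaZ2.Theorems.CardyIKTransportIKLinearTransportPinnedDefs
import Summits.CriticalPhenomena.CardyFormulaZ2.Theorems.CardyIKTransportIKLinearTransportStubPinnedExchange

/-!
# Stub `stub_StripDiagramExchange` — plumbing part 1: re-anchoring the gauge at cell column `i`

Toward `StripDiagramExchange S i` (line `pinned-diagram-exchange`, crux stmt-CriticalPhenomena-5076). The gauge
`obs S` anchors the plaquette rectangles of its colour field at column `0`; the law `νmix S` is also the law of the
observables `SDE.obsA i S` whose rectangles are anchored at cell column `i` (`SDE.nuMix_eq_map_obsA`), by a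
`μIK`-preserving correction of the row bits (the horizontal analogue of the landed `exists_lift_vshift`). With this
anchoring the colours of column `i` are `c_i ⊕ r_y`, those of column `i+1`, `i+2` read only the plaquettes of face
columns `i`, `i+1`, and the colours left of `i` / right of `i+2` read no plaquette of these two columns.
-/

set_option autoImplicit false

noncomputable section

namespace Summit.CriticalPhenomena.CardyFormulaZ2.Theorems.IKLinearTransport.PinnedDiagramExchange

open scoped Classical MeasureTheory ENNReal ProbabilityTheory BigOperators symmDiff
open MeasureTheory Function Literature.Probability.Percolation Literature.Probability.LatticeModels
open Summit.CriticalPhenomena.CardyFormulaZ2.Theorems.IKQuarterTurn (measurePreserving_relabel)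

namespace SDE

/-- Colours of the `S`-mixed model with the plaquette rectangles anchored at cell column `i`. [folklore] -/
def blackA (i : ℤ) (S : Set ℤ) (ω : Ω) : Set (Site 2) :=
  {v | Xor (v 0 ∈ ω.1) (Xor (v 1 ∈ ω.2.1) (Odd ((Finset.filter (fun f : ℤ × ℤ => (![f.1, f.2] : Site 2) ∈ parSet S ω)
    (Finset.Ico (min i (v 0)) (max i (v 0)) ×ˢ Finset.Ico (min 0 (v 1)) (max 0 (v 1)))).card)))}

/-- Observables anchored at cell column `i`. [folklore] -/
def obsA (i : ℤ) (S : Set ℤ) (ω : Ω) : Obs := (blackA i S ω, antiSet S ω)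

/-- Chasles modulo 2 for marks in anchored column strips `[min i x, max i x) × B`. [folklore] -/
theorem odd_card_filter_anchor (P : ℤ × ℤ → Prop) (i x : ℤ) (B : Finset ℤ) :
    Odd ((Finset.Ico (min i x) (max i x) ×ˢ B).filter P).card ↔
      Xor (Odd ((Finset.Ico (min 0 x) (max 0 x) ×ˢ B).filter P).card)
        (Odd ((Finset.Ico (min 0 i) (max 0 i) ×ˢ B).filter P).card) := by
  have cast : ∀ (s : Finset (ℤ × ℤ)) (Q : ℤ × ℤ → Prop), Odd (s.filter Q).card ↔
      (∑ f ∈ s, if Q f then (1 : ZMod 2) else 0) = 1 := fun s Q => by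
    rw [← ZMod.natCast_eq_one_iff_odd, Finset.natCast_card_filter]
  set g : ℤ → ZMod 2 := fun a => ∑ b ∈ B, if P (a, b) then 1 else 0 with hg
  rw [cast, cast, cast, Finset.sum_product, Finset.sum_product, Finset.sum_product]
  have hc := sum_Ico_minmax_chasles g 0 i x
  change (∑ a ∈ Finset.Ico (min i x) (max i x), g a) = 1 ↔
    Xor ((∑ a ∈ Finset.Ico (min 0 x) (max 0 x), g a) = 1) ((∑ a ∈ Finset.Ico (min 0 i) (max 0 i), g a) = 1)
  rw [hc]
  have fin : ∀ (u w : ZMod 2), w = 1 ↔ Xor (u + w = 1) (u = 1) := by decide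
  exact fin _ _

/-- RE-ANCHORING: a `μIK`-preserving map of the bit space after which the column-`0`-anchored observables are the
column-`i`-anchored ones (correct the row bits by the parity of the plaquettes between columns `0` and `i`). [folklore] -/
theorem exists_lift_anchor (S : Set ℤ) (i : ℤ) :
    ∃ Φ : Ω → Ω, MeasurePreserving Φ μIK μIK ∧ ∀ ω, obs S (Φ ω) = obsA i S ω := by
  let R : Type := Set (Site 2) × (Set (Site 2) × Set (Site 2))
  let D : R → Set ℤ := fun br => {y | Odd ((Finset.Ico (min 0 i) (max 0 i) ×ˢ
      Finset.Ico (min 0 y) (max 0 y)).filter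
        (fun f : ℤ × ℤ => (![f.1, f.2] : Site 2) ∈ parSet S (((∅ : Set ℤ), ((∅ : Set ℤ), br)) : Ω))).card}
  have hDm : ∀ y : ℤ, Measurable fun br : R => y ∈ D br := fun y =>
    measurable_odd_card_filter (fun (f : ℤ × ℤ) =>
      ((measurable_obs' S).1 ![f.1, f.2]).comp (measurable_const.prodMk (measurable_const.prodMk measurable_id))) _
  have hgm : Measurable (uncurry fun (br : R) (a : Set ℤ) => a ∆ D br) := by
    refine measurable_set_iff.2 fun y => ?_
    simp only [uncurry, Set.mem_symmDiff]
    have ha : Measurable fun p : R × Set ℤ => y ∈ p.2 := (measurable_set_mem y).comp measurable_snd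
    have hd : Measurable fun p : R × Set ℤ => y ∈ D p.1 := (hDm y).comp measurable_fst
    exact (ha.and hd.not).or (hd.and ha.not)
  refine ⟨fun ω => (ω.1, (ω.2.1 ∆ D ω.2.2, ω.2.2)), ?_, fun ω => ?_⟩
  · unfold μIK
    exact (MeasurePreserving.id _).prod
      (measurePreserving_swapSkew (MeasurePreserving.id _) hgm fun br => sitePercolation_half_map_symmDiff (D br))
  · have hpar : parSet S ((ω.1, (ω.2.1 ∆ D ω.2.2, ω.2.2)) : Ω) = parSet S ω := rfl
    have hD : parSet S (((∅ : Set ℤ), ((∅ : Set ℤ), ω.2.2)) : Ω) = parSet S ω := rfl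
    refine Prod.ext ?_ rfl
    ext v
    have key := odd_card_filter_anchor (fun f : ℤ × ℤ => (![f.1, f.2] : Site 2) ∈ parSet S ω) i (v 0)
      (Finset.Ico (min 0 (v 1)) (max 0 (v 1)))
    simp only [obs, obsA, blackSet, blackA, Set.mem_setOf_eq, hpar]
    simp only [Set.mem_symmDiff, D, Set.mem_setOf_eq, hD]
    grind

/-- The anchored observables are measurable. [folklore] -/
theorem measurable_obsA (i : ℤ) (S : Set ℤ) : Measurable (obsA i S) := by
  have hp := (measurable_obs' S).1
  have hb : Measurable (blackA i S) := by
    refine measurable_set_iff.2 fun v => ?_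
    have ha : Measurable fun ω : Ω => v 0 ∈ ω.1 := (measurable_set_mem (v 0)).comp measurable_fst
    have hb : Measurable fun ω : Ω => v 1 ∈ ω.2.1 := (measurable_set_mem (v 1)).comp (measurable_fst.comp measurable_snd)
    have hc := measurable_odd_card_filter (fun (f : ℤ × ℤ) => hp ![f.1, f.2])
      (Finset.Ico (min i (v 0)) (max i (v 0)) ×ˢ Finset.Ico (min 0 (v 1)) (max 0 (v 1)))
    have hx : ∀ {p q : Ω → Prop}, Measurable p → Measurable q → Measurable fun a => Xor (p a) (q a) :=
      fun hp hq => (hp.and hq.not).or (hq.and hp.not)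
    exact hx ha (hx hb hc)
  exact hb.prodMk (measurable_obs' S).2.2.snd

/-- THE LAW OF THE OBSERVABLES IS THE LAW OF THE RE-ANCHORED OBSERVABLES. [folklore] -/
theorem nuMix_eq_map_obsA (S : Set ℤ) (i : ℤ) : νmix S = μIK.map (obsA i S) := by
  obtain ⟨Φ, hΦ, hobs⟩ := exists_lift_anchor S i
  rw [νmix]
  conv_lhs => rw [← hΦ.map_eq]
  rw [Measure.map_map (measurable_obs' S).2.2 hΦ.measurable]
  congr 1
  funext ω
  exact hobs ω

end SDE

/-- RE-ANCHORING (plumbing part 1 of `stub_StripDiagramExchange`): `νmix S` is the law of the observables whose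
plaquette rectangles are anchored at cell column `i`. [folklore] -/
theorem stripDX_reanchor : ∀ (S : Set ℤ) (i : ℤ), νmix S = μIK.map (SDE.obsA i S) :=
  fun S i => SDE.nuMix_eq_map_obsA S i

end Summit.CriticalPhenomena.CardyFormulaZ2.Theorems.IKLinearTransport.PinnedDiagramExchange
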